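import Mathlib
import Summits.MatrixMultiplication.MatrixMultiplication.Theses.SnSubsetDichotomy
import Literature.Barriers.MatrixMultiplication.NilpotentGroupBarrierSemisimple
import Literature.Barriers.MatrixMultiplication.NilpotentGroupBarrierGradedCoords

/-!
# Line `modular-radical-filtration` — skeleton for crux `SnSubsetDichotomy.PolynomialSlack`
# (stmt-MatrixMultiplication-8306, route-MatrixMultiplication-SnSubsetDichotomy; crux-plan, round 1)

**Crux (by name).** `PolynomialSlack : ∀ C, ∃ n₀, ∀ n ≥ n₀, every TPP triple S,T,U ⊆ S_n has
|S||T||U|·n^C ≤ (n!)^{3/2}` — a super-polynomial saving below the packing bound for ALL subsets.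

**Idea (card `modular-radical-filtration`, ideator 3; triage r1-1/2/3: pass ×3, "weak": cross-crux
duplicate of the 8302 line `two-modular-loewy-slice-rank` at p = 2, RoCK heuristic void at p = 2).**
Bound the slice rank of the group tensor `D_{S_n}(x,y,z) = [xyz = 1]` over `𝔽_p` by the BCCGU 2017
codimension bound (Prop. 3.2 / Lemma 3.3) for the BLOCKWISE RADICAL FILTRATION of `𝔽_p[S_n]`, and
transfer: a TPP triple of subsets embeds `⟨m,m,m⟩`, `m = min(|S|,|T|,|U|)`, into `D_{S_n}` over every
field (Cohn–Umans), so `(|S||T||U|)² ≤ (n!)²·slice-rank` (`stub_volume`, rate-free) and a saving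
`slice-rank ≤ 3·n!·n^{−(2C+1)}` gives the crux.

**What this skeleton adds to the card (planner's sharpening, answering triage r1-2 (b)/r1-3 and
r1-1 (1)–(2)).**  The prime is taken in the MESOSCOPIC RANGE `n < p² ≤ 5n` (`p ≍ √n`, supplied by
Bertrand's postulate in the glue), not `p = 2`:
* `n < p²` forces EVERY block of `𝔽_p S_n` to have weight `w ≤ n/p < p`, i.e. ABELIAN defect group
  `(C_p)^w` — the regime where the card's structural model is in scope (Chuang–Kessar: RoCK blocks of
  weight `w < p` are Morita equivalent to `B₀(𝔽_p(S_p ≀ S_w))`, whose radical layers are the `w`-fold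
  convolution of the Brauer-line layers `(1,2,1)`, a `Binomial(2w, ½)` profile of Loewy length
  `2w+1` = Chuang–Tan; Chuang–Rouquier: all weight-`w` blocks are derived equivalent), instead of
  the wild principal 2-block where it is void;
* `p² ≤ 5n` keeps `p ≤ 2.24√n` inside the non-degenerate range `(√n, 4√n)`: Plancherel-typical
  `λ ⊢ n` (`λ₁, λ₁' ≈ 2√n`) are then `p`-regular, are almost never `p`-cores (defect 0), and
  carry `p`-weight `w_p(λ) = #{cells of hook length p (or 2p, 3p)} ≍ √n ≫ log n`, sharply
  concentrated (an O(1)-Lipschitz statistic of the determinantal Plancherel point process); the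
  dimension-weighted block distribution IS the Plancherel law of `p`-cores (`dim B = Σ_{λ∈B}(f^λ)²`).
So the two open stubs say: for primes `p ≍ √n`, (FLOOR) simple modules of the abelian-defect blocks
are super-polynomially smaller than the Plancherel mass, `Σ_{λ p-regular}(dim D^λ)² ≤ n!·n^{−C}`
(`stub_mesoFloor`; RoCK model: ratio `≈ 4^{−w}`), and (WINDOW) for some MULTIPLICATIVE FILTRATION OF
THE RADICAL `J = F₁ ⊇ F₂ ⊇ …`, `F_c·F_d ⊆ F_{c+d}` (the card's instance: `F_a = J^a`; the natural
second witness in this range: `F_a` = degree-`≥ a` part of the Brundan–Kleshchev–Rouquier grading,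
which on abelian-defect blocks is non-negative with semisimple degree 0, `c_{μν}(v) ∈ δ_{μν} + vℕ[v]`,
so `F₁ = J`; the two coincide iff the block is Koszul), blockwise windows `[b_B, a_B + b_B)` capture
all but `n!·n^{−C}` of the layers ≥ 1 (`stub_mesoWindow`; RoCK model: binomial tails `e^{−Θ(w)}`;
any witness needs Loewy length ≫ log n, which here is `2w+1 ≍ √n` wherever Martin's conjecture /
Chuang–Tan applies, and the graded profile `Σ_{μν} d_μ d_ν c_{μν}(v)` is computable by the LLT
algorithm wherever James's conjecture holds — weights ≤ 4, Fayers).  Blockwise thresholds (triage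
r1-1 (1)) are built into the statement through a family of central orthogonal idempotents; the
Loewy-length-growth milestone (r1-1 (2), r1-2 (b)) is automatic in this range for RoCK blocks and is
exactly Martin's conjecture otherwise.
The `p = 2` instance of the card is NOT re-registered: it is literally the 8302 skeleton
(`stub_semisimpleFloor`, `stub_radicalWindow` there imply the `p = 2` analogues of the two witness
stubs here at the stronger rate `e^{−K√n}`), and `stub_codim` below is shared VERBATIM with it.

**Composition.** `PolynomialSlack_of : PolynomialSlack` (sorry-free glue; `sorry` only inside the four
`stub_*`): Bertrand prime `p` with `n < p² ≤ 5n` (`exists_prime_sq_window`, `n ≥ 81`); block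
subspaces `𝒜 = ⨆ᵢ 𝔽_p eᵢ·F_{aᵢ}`, `ℬ = ⨆ᵢ 𝔽_p eᵢ·F_{bᵢ}`, `𝒞 = ⨆ᵢ 𝔽_p eᵢ·F_{aᵢ+bᵢ}` with
`𝒜·ℬ ≤ 𝒞` PROVED from centrality + orthogonality + multiplicativity (`blockFil_mul_le`); `stub_codim` ⇒
`SR ≤ (n! − dim 𝒜) + (n! − dim ℬ) + dim 𝒞 = 2(n! − dim J) + [(dim J − dim 𝒜) + (dim J − dim ℬ) + dim 𝒞]`
`≤ 3·n!·n^{−(2C+1)} ≤ n!·n^{−2C}` (floor + window at exponent `2C+1`, `n ≥ 3`); `stub_volume` ⇒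
`(|S||T||U|·n^C)² ≤ (n!)³`, i.e. the crux.

**Disproof used** (cdisprove v1–v4 on the item; the file under `run/gate/evidence/…` is not mounted in
this seat and is not a crux workfile — read through the four evidence notes, as all three triagers
did; no `Theorems/PolynomialSlack/Negative/` lemma has landed, nothing to import):
§2 `polynomialSlack_false_without_TPP` / `_false_without_triple'` — the TPP is consumed exactly once,
three-fold, in `stub_volume` (through `RealizesTPP.tensorRestrictsTo`; pairwise uniqueness of
quotients gives no tensor restriction); §4 (uniform-in-C / fixed-n strengthenings false) — every stub
and the glue are `∀ C ∃ n₀` eventual statements, the constant `3` is absorbed by `n ≥ 3`, never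
uniformly; §6 `not_exponentialSaving` (triangle TPP triples, `(n!)^{3/2}e^{−O(n)}`) — consistent: the
method's ceiling here is `n!·E_Planch[ρ^{w_p}] = n!·e^{−O(√n)}`, far above `e^{−O(n)}`; §3 (C ≤ 0 from
packing + rotation) — `stub_volume` is the slice-rank refinement of that very lemma (`m² ≤ SR` in
place of `m ≤ √(n!)`); §1 (¬crux ⇒ ω = 2) — untouched, this is a proof line.
Negatives index (`ledger negatives --problem MatrixMultiplication`): STPP line/frame designs and
design flattening only — no stub restates a refuted statement, the crux, or the summit.
-/

namespace Summit.MatrixMultiplication.MatrixMultiplication.Cruxes.PolynomialSlack.ModularRadicalFiltration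

open scoped BigOperators
open Literature.Barriers.MatrixMultiplication Literature.Combinatorics.Additive
open Literature.Computability.AlgebraicComplexity
open Summit.MatrixMultiplication.MatrixMultiplication.Theses.SnSubsetDichotomy

set_option linter.dupNamespace false

/-- `𝔸⟦p, n⟧ = 𝔽_p[S_n]` (`MonoidAlgebra (ZMod p) (Equiv.Perm (Fin n))`; `𝔽_p` is a splitting field
of `S_n`, so all dimensions below are the same over `𝔽̄_p`). -/
local notation "𝔸⟦" p ", " n "⟧" => MonoidAlgebra (ZMod p) (Equiv.Perm (Fin n))

/-- `J⟦p, n⟧` = the Jacobson radical `J(𝔽_p[S_n])` (Mathlib `Ring.jacobson`, a two-sided ideal)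
viewed as an `𝔽_p`-subspace; its powers `J⟦p, n⟧ ^ a` in the semiring `Submodule (ZMod p) 𝔸⟦p, n⟧`
are the radical powers `J^a` (`J^0 = 𝔽_p·1`). -/
local notation "J⟦" p ", " n "⟧" =>
  (Submodule.restrictScalars (ZMod p)
    (Ring.jacobson (MonoidAlgebra (ZMod p) (Equiv.Perm (Fin n)))) :
      Submodule (ZMod p) (MonoidAlgebra (ZMod p) (Equiv.Perm (Fin n))))

/-! ## The four stubs -/

/-- **Stub 1 — the rate-free volume bound (transfer; size M, provable now from tree theorems).**
For every field `F`, finite group `G` and TPP triple `S, T, U ⊆ G`: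
`(|S||T||U|)² ≤ |G|²·slice-rank_F D_G`.
Proof: the TPP is invariant under cyclic rotation `(S,T,U) ↦ (T,U,S)` (conjugate
`s s'⁻¹·t t'⁻¹·u u'⁻¹ = 1`), so the packing bound `RealizesTPP.mul_le_card` applied to the three
rotations gives `|S||T|, |T||U|, |U||S| ≤ |G|` (when the third set is non-empty; if some set is
empty the claim is `0 ≤ _`); hence `|S||T||U| ≤ m·|G|` with `m = min(|S|,|T|,|U|)`; shrinking to
sub-`m`-sets (`Finset.exists_subset_card_eq`, `TripleProductProperty.mono`) gives
`RealizesTPP G m m m`, and `m² ≤ sliceRank (mulGroupTensor F G)` is the tree THEOREM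
`BCCGU2017_propB6.sq_le_sliceRank_of_realizesTPP BCCGU2017_propB6_holds` (Cohn–Umans embedding of
`⟨m,m,m⟩` + BCCGU Prop. B.6 over every field). So `(|S||T||U|)² ≤ m²|G|² ≤ |G|²·SR`.
This is the common rate-free core of the card's `SliceRankSavingImpliesPolynomialSlack`, of the 8302
line's `stub_transfer` (which is this + `exp/sqrt` bookkeeping) and of Disproof §3 (`C ≤ 0`): one
proof serves all three. Honours Disproof §2 (`false_without_TPP`, `false_without_triple'`): the
genuine three-fold condition enters through `RealizesTPP.tensorRestrictsTo`.
[BlasiakChurchCohnGrochowUmans2017 = arXiv:1712.02302, Prop. 2.10 / Prop. B.6; CohnUmans2003 Thm 2.3,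
Lemma 3.1; tree: `RealizesTPP`, `RealizesTPP.mul_le_card`, `TripleProductProperty.mono`,
`BCCGU2017_propB6_holds`, `sliceRank_groupTensor`] -/
theorem stub_volume (F : Type) [Field F] (G : Type) [Group G] [Fintype G] [DecidableEq G]
    (S T U : Finset G) (hTPP : TripleProductProperty S T U) :
    (S.card * T.card * U.card) ^ 2 ≤ Fintype.card G ^ 2 * sliceRank (mulGroupTensor F G) := by
  sorry

/-- **Stub 2 — BCCGU 2017, Prop. 3.2: the codimension bound over SUBSPACES (size M–L, provable now;
VERBATIM the 8302 line's `stub_codim`, one proof serves both cruxes and the KLR line).**  For a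
finite group `G`, a field `F` and `F`-subspaces `A, B, C` of `F[G]` with `A·B ⊆ C`:
`slice-rank_F D_G ≤ codim A + codim B + dim C`, written additively (`dim F[G] = |G|`).
Proof (BCCGU, held text p. 5 Prop. 13): bases of `F[G]` through `A` (leg x), `B` (leg y), `C`
(leg z); in these coordinates `D_G(x,y,z) = Σ_k P_C(k,z⁻¹) Σ_j Q_B(y,j) Σ_i Q_A(x,i)·c(i,j,k)` with
`c(i,j,k)` the `z_k`-coordinate of `xᵢ·yⱼ` (three-basis version of `GradedCoords.mulGroupTensor_eq_subst`),
`A·B ⊆ C` puts `c` on `dx i + dy j ≤ dz k` for indicator degrees, `HasSliceRankLE.of_graded` at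
`a = b = 1` counts `codim A + codim B + dim C`, `HasSliceRankLE.subst_left/mid/right` undo the base
changes. [BlasiakChurchCohnGrochowUmans2017, Lemma 3.1 + Prop. 3.2; tree: `GradedCoords.hasSliceRankLE`
(one-basis case, PROVED), `HasSliceRankLE.of_graded`, `.subst_*`, `Module.finrank_finsupp_self`] -/
theorem stub_codim (F : Type) [Field F] (G : Type) [Group G] [Fintype G] [DecidableEq G]
    (A B C : Submodule F (MonoidAlgebra F G)) (hABC : A * B ≤ C) :
    sliceRank (mulGroupTensor F G) + Module.finrank F A + Module.finrank F B ≤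
      2 * Fintype.card G + Module.finrank F C := by
  sorry

/-- **Stub 3 — the MESOSCOPIC SEMISIMPLE FLOOR is thin (layer 0; size XL; plausible-open, RoCK case
by formula).**  For every `C`, eventually in `n`, for every prime `p` with `n < p² ≤ 5n`:
`n! − dim_{𝔽_p} J(𝔽_p S_n) = Σ_{λ ⊢ n p-regular} (dim D^λ)² ≤ n!·n^{−C}`.
Why plausible: in this range every block `B` has weight `w = w_p < p` (abelian defect) and
`dim(B/J(B))/dim B = Σ_μ d_μ²/Σ_μ d_μ·dim P_μ ≤ 1/min_μ c_{μμ}`; in the Chuang–Kessar model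
`B₀(𝔽_p(S_p ≀ S_w))` of a RoCK block the ratio is exactly `(Σ_k C(p−2,k)²/Σ_k C(p−1,k)²)^w ≈ 4^{−w}`
(Brauer line: `dim D^{(p−k,1^k)} = C(p−2,k)`), and decomposition numbers — hence `c_{μμ} ≥ 2^w`-type
column supports — are Morita invariants; weight-1 blocks give the factor `¼…½` per unit of weight in
general (alternating sums along the Brauer path). Plancherel side: `dim B = Σ_{λ∈B}(f^λ)²`, and for
`√n < p ≤ 2.24√n` the weight `w_p(λ) = #{hooks of λ divisible by p}` of a Plancherel partition is a
O(1)-Lipschitz statistic of the (determinantal, Borodin–Okounkov–Olshanski) descent process with mean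
`≍ √n`, so `P_Planch(w_p ≤ K log n) ≤ e^{−Ω(√n)}` (Pemantle–Peres concentration) — blocks of small
weight are negligible (RoCK blocks themselves do not occur among the heavy blocks of `S_n` at `p ≍ √n`:
Rouquier cores for weight `w ≥ 3` are larger than `n`; they are the derived-class MODEL, Chuang–Rouquier).
Why it might fail: for the Plancherel-typical cores (near-flat `p`-abacus: bead counts varying by O(1)
across runners, cores of size Θ(n), maximally far from RoCK) the ratio `dim(B/J)/dim B` is not in print;
if simples of typical abelian blocks were only polynomially-in-`w` smaller than the block, the floor —
and the line — dies. EVIDENCE (kit j010065 + local, `compute/llt/llt.py`, LLT canonical bases, all cores,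
`p ∈ {5,7,11}`): per-block share `dim(B/J)/dim B` = 0.26–0.40, 0.075–0.18, 0.023–0.056, 0.013–0.025,
0.0043 for `w = 1,…,5` — geometric, ≈ ×0.35 per unit weight, uniform in `p` and core. Degenerate ends
excluded by the range: `p² ≤ n` (wild blocks) and `p ≥ 4√n` (almost all `λ` are `p`-cores ⇒ no saving,
`BCCGU2017_corB7_holds`).
[ChuangKessar2002 (Bull. LMS 34, 174–184) and ChuangRouquier2008 (Ann. Math. 167) as reported in
Craven, *Representation Theory of Finite Groups: a Guidebook* (isbn 9783030217914) §8.3 — READ: RoCK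
definition (`w−1` more beads on each successive runner; `p = 3, w = 2` ⇒ core `(3,1,1)`, block in
`S₁₁`), Chuang–Kessar Morita theorem for `p > w`, Scopes' Morita moves Thm 8.3.4, James's conjecture
(false in general, true for weights ≤ 4: Fayers); ChuangTan2003 = doi:10.1017/S0305004103006984
(MPCPS 135) Lemma 3.5(1) — READ: `rad^n(A ≀ S_w) = rad^n(A^{⊗w}) ⊗ kS_w` when `w! ∈ k×`, and Prop. 7.1
(graded radical multiplicities of the Brauer-line wreath algebra); Scopes1991 (J. Algebra 142);
James1978 LNM 682 Thm 11.5; BorodinOkounkovOlshanski2000 (JAMS 13); BorceaBrandenLiggett2009 (JAMS 22);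
PemantlePeres2014 (CPC 23); Rostam (e-core size of Plancherel partitions — arXiv id to confirm);
BlasiakChurchCohnGrochowUmans2017 Cor. B.7 / §6 p. 11; Pratt2022 arXiv:2210.05488 Lem. 2.4–2.5
(`SR ≥ dim A/J`: the floor is NECESSARY for any radical-type witness)] -/
theorem stub_mesoFloor :
    ∀ C : ℝ, ∃ n₀ : ℕ, ∀ n ≥ n₀, ∀ (p : ℕ) [Fact p.Prime], n < p ^ 2 → p ^ 2 ≤ 5 * n →
      ((n.factorial : ℝ) - (Module.finrank (ZMod p) J⟦p, n⟧ : ℝ)) * (n : ℝ) ^ C ≤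
        (n.factorial : ℝ) := by
  sorry

/-- **Stub 4 — BLOCKWISE WINDOWS OF A MULTIPLICATIVE FILTRATION OF THE RADICAL in the mesoscopic range
(layers ≥ 1; size XL; OPEN — the load-bearing bet).**  For every `C`, eventually in `n`, for every
prime `p` with `n < p² ≤ 5n` there are: a multiplicative filtration of the radical
`F : ℕ → {subspaces}`, `F₁ = J(𝔽_pS_n)`, antitone, `F_c·F_d ⊆ F_{c+d}` (hence `J^c ⊆ F_c ⊆ J`;
INTENDED WITNESSES: the radical powers `F_c = J^c` — the card's instance, Loewy layers — or the
degree filtration `F_c = B_{≥c}` of the Brundan–Kleshchev–Rouquier grading, non-negative with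
semisimple degree-0 part on abelian-defect blocks since `c_{μν}(v) ∈ δ_{μν} + vℕ[v]`; equal iff
Koszul), central orthogonal idempotents `eᵢ` (intended: sums of block idempotents) and thresholds
`aᵢ, bᵢ` such that, with `𝒜 = ⨆ᵢ 𝔽_p eᵢ·F_{aᵢ} = ⊕ᵢ eᵢF_{aᵢ}`, `ℬ = ⊕ᵢ eᵢF_{bᵢ}`, `𝒞 = ⊕ᵢ eᵢF_{aᵢ+bᵢ}`:
`(dim J − dim 𝒜) + (dim J − dim ℬ) + dim 𝒞 ≤ n!·n^{−C}`.
For a complete family and `aᵢ ≤ bᵢ` this says: in each block `B` the layers `dim F_i(B)/F_{i+1}(B)`,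
`i ≥ 1`, put all but (a share of) `n!·n^{−C}` of their mass in the window `bᵢ ≤ i < aᵢ + bᵢ` —
per-block thresholds, as triage r1-1 (1) asked; the graded witness has the COMPUTABLE profile
`Σ_{μ,ν} d_μ d_ν·c_{μν}(v)`, `C(v) = D(v)ᵀD(v)`, `D(v)` = LLT canonical basis wherever James's
conjecture holds (weights ≤ 4: Fayers; false for some huge `p`: Williamson). Why plausible: in this
range every block has abelian defect `(C_p)^w`, `w < p`; for RoCK blocks (Chuang–Kessar Morita model
`B₀(𝔽_pS_p) ≀ S_w`, `𝔽_pS_w` semisimple) the dimension-weighted layer profile is the `w`-fold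
convolution of `(t, m, t)` with `m ≈ 2t`, i.e. `≈ Binomial(2w, ½)·dim B`: Loewy length `2w+1`
(Chuang–Tan) and window `[2w/3, 4w/3)` with tails `e^{−Θ(w)}`; by symmetric-algebra duality
(`dim A/J^a = dim soc^a A ≥ dim J^{LL−a}`) ANY witness needs `LL(B) ≫ C·log n` with CLT-scale
concentration (triage r1-2 (b)) — here `LL = 2w+1 ≍ √n` wherever Martin's conjecture holds (RoCK:
theorem; `w ≤ 2`: Scopes; general `w < p`: conjecture), versus the unknown growth of `LL(B₀(𝔽₂S_n))`
the `p = 2` instance needs. Plancherel side as in Stub 3 (`w_p ≍ √n` sharply; small-weight blocks cost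
`e^{−Ω(√n)}`). EVIDENCE for the graded witness (kit j010065 + local, 1530+ blocks, `p ∈ {5,7,11}`, every
core, `w ≤ 5`; the grading is the non-negative regrading `B ≅ End_B(⊕ P̂_μ^{d_μ})^op` through graded
lifts of projectives, `F₁ = J`, layers `Σ_{μν} d_μd_ν[v^k]c_{μν}(v)`): bell-shaped palindromic profiles,
mean `w`, sd ≈ `0.80√w` (CLT scaling), best per-block split share 1.0, 0.77, 0.66, 0.57, 0.48 for
`w = 1..5` (Binomial(2w,½) model 0.69, 0.56, 0.43, 0.40, 0.34: a lag of one unit of weight).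
Why it might fail: the heavy blocks of `S_n` at `p ≍ √n` are never RoCK (Rouquier cores
for `w ≥ 3` exceed `n`), only DERIVED equivalent to the RoCK block of their weight in a larger symmetric
group (Chuang–Rouquier; perverse equivalences shift Loewy layers), and their
radical layer DIMENSIONS are not in print beyond `w ≤ 2`; a flat or end-heavy profile for typical
abelian blocks kills the stub (data point against the `p = 2` sibling: `B₀(𝔽₂S_5)` has layers
`[17,9,9,18,9,9,17]`, end-heavy; for the meso instance: kit GAP jobs of triage r1-1 (j008555:
blockwise `J^k`, `p ∈ {2,3,5,7}`, `n ≤ 7`) land on the item). Honest ceiling: `n!·E_Planch[ρ^{w_p}]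
= n!·e^{−O(√n)}` — enough for this crux (and formally for 8302's `e^{−c√n}`), never more (Disproof §6).
[ChuangTan2003b = doi:10.1112/S0024611502013953 (Proc. LMS 86, "Filtrations in Rouquier blocks of
symmetric groups and Schur algebras") — Loewy structure of Rouquier blocks, `w < p`; ChuangTan2003 =
doi:10.1017/S0305004103006984 Lemma 3.5(1), Prop. 7.1 — READ (tensor-power radical layers of the wreath
model); ChuangKessar2002; ChuangRouquier2008; Scopes1995 (Quart. J. Math. 46, defect 2); Tan (Martin's
conjecture for weight 3, J. Algebra, ~2008) and the general status of Martin's conjecture — from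
memory, to be confirmed by the lead (`lit search`/searchd was down while authoring; galaxy reads only);
Craven's Guidebook §8.3 — READ (RoCK, Scopes moves, James's conjecture/Fayers w ≤ 4, Evseev–Kleshchev
for w ≥ p); BlasiakChurchCohnGrochowUmans2017 Lemma 3.3 / Prop. 3.10–3.11 (Jennings profile +
Hoeffding: the p-group template of the tail count); Sawin2018 (tree
`exists_sliceRank_mulGroupTensor_pi_le`)] -/
theorem stub_mesoWindow :
    ∀ C : ℝ, ∃ n₀ : ℕ, ∀ n ≥ n₀, ∀ (p : ℕ) [Fact p.Prime], n < p ^ 2 → p ^ 2 ≤ 5 * n →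
      ∃ (Fil : ℕ → Submodule (ZMod p) 𝔸⟦p, n⟧) (ι : Type) (e : ι → 𝔸⟦p, n⟧) (a b : ι → ℕ),
        Fil 1 = J⟦p, n⟧ ∧ Antitone Fil ∧ (∀ c d : ℕ, Fil c * Fil d ≤ Fil (c + d)) ∧
        (∀ i x, e i * x = x * e i) ∧ OrthogonalIdempotents e ∧
        (((Module.finrank (ZMod p) J⟦p, n⟧ : ℝ) -
              (Module.finrank (ZMod p)
                ↥(⨆ i, Submodule.span (ZMod p) {e i} * Fil (a i)) : ℝ)) +
            ((Module.finrank (ZMod p) J⟦p, n⟧ : ℝ) -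
              (Module.finrank (ZMod p)
                ↥(⨆ i, Submodule.span (ZMod p) {e i} * Fil (b i)) : ℝ)) +
            (Module.finrank (ZMod p)
              ↥(⨆ i, Submodule.span (ZMod p) {e i} * Fil (a i + b i)) : ℝ)) *
          (n : ℝ) ^ C ≤ (n.factorial : ℝ) := by
  sorry

/-! ## Glue (sorry-free) -/

/-- **Block algebra.** For central orthogonal idempotents `eᵢ` of an algebra `A` and any
multiplicative family of subspaces `F_c·F_d ⊆ F_{c+d}`:
`(⨆ᵢ 𝔽eᵢ·F_{aᵢ})·(⨆ⱼ 𝔽eⱼ·F_{bⱼ}) ≤ ⨆ᵢ 𝔽eᵢ·F_{aᵢ+bᵢ}` — cross terms vanish (`eᵢeⱼ = 0`), diagonal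
terms are `eᵢ·(F_{aᵢ}F_{bᵢ}) ⊆ eᵢ·F_{aᵢ+bᵢ}` (`eᵢ` central, `eᵢ² = eᵢ`). This is what makes the
blockwise window an instance of Prop. 3.2 (`stub_codim`). -/
theorem blockFil_mul_le {F : Type} [Field F] {A : Type} [Ring A] [Algebra F A] {ι : Type}
    (e : ι → A) (hcen : ∀ i x, e i * x = x * e i) (he : OrthogonalIdempotents e)
    (Fil : ℕ → Submodule F A) (hmul : ∀ c d : ℕ, Fil c * Fil d ≤ Fil (c + d)) (a b : ι → ℕ) :
    (⨆ i, Submodule.span F {e i} * Fil (a i)) * (⨆ i, Submodule.span F {e i} * Fil (b i)) ≤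
      ⨆ i, Submodule.span F {e i} * Fil (a i + b i) := by
  classical
  rw [Submodule.iSup_mul]
  refine iSup_le fun i => ?_
  rw [Submodule.mul_iSup]
  refine iSup_le fun j => ?_
  rw [Submodule.mul_le]
  intro m hm m' hm'
  obtain ⟨z, hz, rfl⟩ := Submodule.mem_span_singleton_mul.1 hm
  obtain ⟨w, hw, rfl⟩ := Submodule.mem_span_singleton_mul.1 hm'
  by_cases hij : i = j
  · subst hij
    have hzw : z * w ∈ Fil (a i + b i) := hmul _ _ (Submodule.mul_mem_mul hz hw)
    have hcalc : e i * z * (e i * w) = e i * (z * w) := by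
      calc e i * z * (e i * w) = z * e i * (e i * w) := by rw [hcen i z]
        _ = z * (e i * e i) * w := by simp only [mul_assoc]
        _ = z * e i * w := by rw [(he.idem i).eq]
        _ = e i * z * w := by rw [hcen i z]
        _ = e i * (z * w) := by rw [mul_assoc]
    rw [hcalc]
    exact le_iSup (fun k => Submodule.span F {e k} * Fil (a k + b k)) i
      (Submodule.mul_mem_mul (Submodule.mem_span_singleton_self _) hzw)
  · have hcalc : e i * z * (e j * w) = 0 := by
      calc e i * z * (e j * w) = e i * (z * e j) * w := by simp only [mul_assoc]
        _ = e i * (e j * z) * w := by rw [hcen j z]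
        _ = (e i * e j) * z * w := by simp only [mul_assoc]
        _ = 0 := by rw [he.ortho hij]; simp
    rw [hcalc]
    exact Submodule.zero_mem _

/-- **A prime in the mesoscopic window** (Bertrand's postulate from `⌊√n⌋ + 1`): for `n ≥ 81` there
is a prime `p` with `n < p² ≤ 5n`. -/
theorem exists_prime_sq_window (n : ℕ) (hn : 81 ≤ n) :
    ∃ p : ℕ, p.Prime ∧ n < p ^ 2 ∧ p ^ 2 ≤ 5 * n := by
  obtain ⟨p, hp, hlt, hle⟩ :=
    Nat.exists_prime_lt_and_le_two_mul (Nat.sqrt n + 1) (Nat.succ_ne_zero _)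
  refine ⟨p, hp, ?_, ?_⟩
  · calc n < (Nat.sqrt n + 1) ^ 2 := Nat.lt_succ_sqrt' n
      _ ≤ p ^ 2 := Nat.pow_le_pow_left hlt.le 2
  · have hs : Nat.sqrt n ^ 2 ≤ n := Nat.sqrt_le' n
    have h9 : 9 ≤ Nat.sqrt n := by
      rw [Nat.le_sqrt']
      omega
    nlinarith [hle, hs, h9]

/-- **`PolynomialSlack` from the line** (no hypotheses; `sorry` only inside the four `stub_*`):
Bertrand prime `p ≍ √n`; block subspaces `𝒜, ℬ, 𝒞`; `stub_codim` + `blockFil_mul_le` ⇒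
`SR ≤ 2(n! − dim J) + [(dim J − dim 𝒜) + (dim J − dim ℬ) + dim 𝒞] ≤ 3·n!·n^{−(2C+1)} ≤ n!·n^{−2C}`
(`stub_mesoFloor` + `stub_mesoWindow` at exponent `2C+1`, `n ≥ 3`); `stub_volume` ⇒
`(|S||T||U|)²·n^{2C} ≤ (n!)²·SR·n^{2C} ≤ (n!)³`; square roots. -/
theorem PolynomialSlack_of : PolynomialSlack := by
  intro C
  obtain ⟨n₃, h₃⟩ := stub_mesoFloor (2 * C + 1)
  obtain ⟨n₄, h₄⟩ := stub_mesoWindow (2 * C + 1)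
  refine ⟨max (max n₃ n₄) 81, fun n hn S T U hTPP => ?_⟩
  have hn₃ : n₃ ≤ n := le_trans (le_max_left _ _) (le_trans (le_max_left _ _) hn)
  have hn₄ : n₄ ≤ n := le_trans (le_max_right _ _) (le_trans (le_max_left _ _) hn)
  have h81 : 81 ≤ n := le_trans (le_max_right _ _) hn
  obtain ⟨p, hp, hnp, hp5⟩ := exists_prime_sq_window n h81
  haveI : Fact p.Prime := ⟨hp⟩
  have hF := h₃ n hn₃ p hnp hp5
  obtain ⟨Fil, ι, e, a, b, -, -, hmul, hcen, horth, hW⟩ := h₄ n hn₄ p hnp hp5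
  -- the three block subspaces of BCCGU Prop. 3.2
  set 𝒜 : Submodule (ZMod p) 𝔸⟦p, n⟧ :=
    ⨆ i, Submodule.span (ZMod p) {e i} * Fil (a i) with h𝒜
  set ℬ : Submodule (ZMod p) 𝔸⟦p, n⟧ :=
    ⨆ i, Submodule.span (ZMod p) {e i} * Fil (b i) with hℬ
  set 𝒞 : Submodule (ZMod p) 𝔸⟦p, n⟧ :=
    ⨆ i, Submodule.span (ZMod p) {e i} * Fil (a i + b i) with h𝒞
  have hABC : 𝒜 * ℬ ≤ 𝒞 := blockFil_mul_le e hcen horth Fil hmul a b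
  have hcod := stub_codim (ZMod p) (Equiv.Perm (Fin n)) 𝒜 ℬ 𝒞 hABC
  have hvol := stub_volume (ZMod p) (Equiv.Perm (Fin n)) S T U hTPP
  rw [Fintype.card_perm, Fintype.card_fin] at hcod hvol
  -- pass to ℝ
  have hcodR : (sliceRank (mulGroupTensor (ZMod p) (Equiv.Perm (Fin n))) : ℝ) +
      (Module.finrank (ZMod p) 𝒜 : ℝ) + (Module.finrank (ZMod p) ℬ : ℝ) ≤
        2 * (n.factorial : ℝ) + (Module.finrank (ZMod p) 𝒞 : ℝ) := by
    exact_mod_cast hcod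
  have hvolR : (((S.card * T.card * U.card : ℕ) : ℝ)) ^ 2 ≤
      (n.factorial : ℝ) ^ 2 * (sliceRank (mulGroupTensor (ZMod p) (Equiv.Perm (Fin n))) : ℝ) := by
    exact_mod_cast hvol
  set R : ℝ := (sliceRank (mulGroupTensor (ZMod p) (Equiv.Perm (Fin n))) : ℝ) with hR
  set N : ℝ := (n.factorial : ℝ) with hN
  set V : ℝ := ((S.card * T.card * U.card : ℕ) : ℝ) with hV
  set dJ : ℝ := (Module.finrank (ZMod p) J⟦p, n⟧ : ℝ) with hdJ
  set dA : ℝ := (Module.finrank (ZMod p) 𝒜 : ℝ) with hdA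
  set dB : ℝ := (Module.finrank (ZMod p) ℬ : ℝ) with hdB
  set dC : ℝ := (Module.finrank (ZMod p) 𝒞 : ℝ) with hdC
  have hn0 : (0 : ℝ) < n := by exact_mod_cast (show 0 < n by omega)
  have hN0 : 0 ≤ N := Nat.cast_nonneg _
  have hE : 0 ≤ (n : ℝ) ^ (2 * C + 1) := Real.rpow_nonneg hn0.le _
  -- slice rank ≤ 3·n!·n^{-(2C+1)}
  have hRle : R ≤ (N - dJ) + (N - dJ) + ((dJ - dA) + (dJ - dB) + dC) := by linarith
  have hR3 : R * (n : ℝ) ^ (2 * C + 1) ≤ 3 * N := by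
    have h1 := mul_le_mul_of_nonneg_right hRle hE
    have h2 : ((N - dJ) + (N - dJ) + ((dJ - dA) + (dJ - dB) + dC)) * (n : ℝ) ^ (2 * C + 1) =
        (N - dJ) * (n : ℝ) ^ (2 * C + 1) + (N - dJ) * (n : ℝ) ^ (2 * C + 1) +
          ((dJ - dA) + (dJ - dB) + dC) * (n : ℝ) ^ (2 * C + 1) := by ring
    linarith [hF, hW]
  -- volume
  have hV3 : V ^ 2 * (n : ℝ) ^ (2 * C + 1) ≤ 3 * N ^ 3 := by
    calc V ^ 2 * (n : ℝ) ^ (2 * C + 1) ≤ N ^ 2 * R * (n : ℝ) ^ (2 * C + 1) :=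
          mul_le_mul_of_nonneg_right hvolR hE
      _ = N ^ 2 * (R * (n : ℝ) ^ (2 * C + 1)) := by ring
      _ ≤ N ^ 2 * (3 * N) := mul_le_mul_of_nonneg_left hR3 (by positivity)
      _ = 3 * N ^ 3 := by ring
  -- absorb the constant: 3 ≤ n
  have h3n : (3 : ℝ) ≤ n := by exact_mod_cast (show 3 ≤ n by omega)
  have hpow : (n : ℝ) ^ (2 * C + 1) = (n : ℝ) ^ (2 * C) * n := by
    rw [Real.rpow_add hn0, Real.rpow_one]
  have hX : 0 ≤ V ^ 2 * (n : ℝ) ^ (2 * C) := by positivity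
  have hV2 : V ^ 2 * (n : ℝ) ^ (2 * C) ≤ N ^ 3 := by
    have h3 : 3 * (V ^ 2 * (n : ℝ) ^ (2 * C)) ≤ 3 * N ^ 3 := by
      calc 3 * (V ^ 2 * (n : ℝ) ^ (2 * C)) ≤ (n : ℝ) * (V ^ 2 * (n : ℝ) ^ (2 * C)) :=
            mul_le_mul_of_nonneg_right h3n hX
        _ = V ^ 2 * ((n : ℝ) ^ (2 * C) * n) := by ring
        _ = V ^ 2 * (n : ℝ) ^ (2 * C + 1) := by rw [hpow]
        _ ≤ 3 * N ^ 3 := hV3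
    linarith
  -- square roots
  have e1 : (V * (n : ℝ) ^ C) ^ 2 = V ^ 2 * (n : ℝ) ^ (2 * C) := by
    rw [mul_pow, show (2 : ℝ) * C = C * 2 by ring, Real.rpow_mul hn0.le, Real.rpow_two]
  have e2 : (N ^ ((3 : ℝ) / 2)) ^ 2 = N ^ 3 := by
    rw [← Real.rpow_natCast (N ^ ((3 : ℝ) / 2)) 2, ← Real.rpow_mul hN0,
      ← Real.rpow_natCast N 3]
    norm_num
  have hsq : (V * (n : ℝ) ^ C) ^ 2 ≤ (N ^ ((3 : ℝ) / 2)) ^ 2 := by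
    rw [e1, e2]
    exact hV2
  exact le_of_pow_le_pow_left₀ two_ne_zero (Real.rpow_nonneg hN0 _) hsq

end Summit.MatrixMultiplication.MatrixMultiplication.Cruxes.PolynomialSlack.ModularRadicalFiltration
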